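import Mathlib
import HarnessLib
import Summits.NavierStokesRegularity.NavierStokesRegularity.Theorems.CompletionRelayChainRelayFrontStepTailProfile

/-!
# `CompletionRelayChain` — crux `RelayFrontStep` (item stmt-NavierStokesRegularity-24850):
  registered stub `stub_slack` of LINE `window_v2` — `L`-FREE BOUNDS ON THE ADMISSIBLE SLACK

The robust front step quantifies over an accumulated (4.10)-slack `0 ≤ B₀ i k ≤ η·slackWeight 1 ½ 8 relayEnv₂ L k`
(`η = 1e-8`) for an ARBITRARY number `L` of past epochs. For the two-piece epoch envelope `relayEnv₂` of LINE
`window_v2` the canonical slack envelope is bounded uniformly in `L`: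

  `slackWeight 1 ½ 8 relayEnv₂ L k = 8·2^{2k}·Σ_{d=1}^{L} 2^{3d}·relayEnv₂(k+d) = 8·2^{−k}·Σ_{m=k+1}^{k+L} 2^{3m}·relayEnv₂ m
     ≤ 8·2^{−k}·(128/3 + 2^{−37})`                                                        (`slackWeight_relayEnv₂_le`)

because the weighted envelope `2^{3m}·relayEnv₂ m` is geometric in both zones: `= 2·4^m = 32·(1/4)^{2−m}` for
`m ≤ 2` (sum `≤ 32/(1 − 1/4) = 128/3`) and `= 2^{25−21m} = 2^{−38}·(2^{−21})^{m−3}` for `m ≥ 3` (sum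
`≤ 2^{−38}/(1 − 2^{−21}) ≤ 2^{−37}`); a finite sum over distinct exponents of a geometric series is at most the
whole series (`finset_sum_le_geometric`). Hence the registered stub `stub_slack`: on the block shells
`k = −3, …, 2` the slack is at most `(2.8e-5, 1.4e-5, 7e-6, 3.5e-6, 1.8e-6, 9e-7)` — the `L`-free hypothesis of the
front-block certificate `stub_frontCert` (skeleton `Cruxes/RelayFrontStep/Lines/window_v2.lean`, reshape v2e).

No definitions. HONEST FRAMING: bookkeeping about the MODEL-lattice slack envelope (Tao 2016 §6.4, Lemma 6.7
shape); one registered S-stub of an open crux; nothing here is a statement about the Navier–Stokes equations.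
-/

noncomputable section

-- the summit-side namespace `Summit.NavierStokesRegularity.NavierStokesRegularity.…` (single-conjunct summit,
-- D-0017) repeats a component by design; the dupNamespace linter would flag every declaration.
set_option linter.dupNamespace false

open Set Literature.Analysis.FluidPDE Literature.Analysis.FluidPDE.TaoCascade

namespace Summit.NavierStokesRegularity.NavierStokesRegularity.Cruxes.RelayFrontStep.Window2

/-! ### A finite sum over distinct exponents of a geometric series -/

/-- If `f m ≤ A·r^{g m}` on a finite set `T` on which `g` is injective (`A ≥ 0`, `0 ≤ r < 1`), then
`Σ_{m ∈ T} f m ≤ A/(1 − r)`. [folklore] -/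
theorem finset_sum_le_geometric {T : Finset ℤ} {f : ℤ → ℝ} {g : ℤ → ℕ} {A r : ℝ} (hA : 0 ≤ A)
    (hr0 : 0 ≤ r) (hr1 : r < 1) (hg : Set.InjOn g T) (hf : ∀ m ∈ T, f m ≤ A * r ^ g m) :
    ∑ m ∈ T, f m ≤ A / (1 - r) := by
  classical
  have h1 : ∑ m ∈ T, f m ≤ ∑ m ∈ T, A * r ^ g m := Finset.sum_le_sum hf
  have h2 : ∑ m ∈ T, A * r ^ g m = A * ∑ n ∈ T.image g, r ^ n := by
    rw [Finset.mul_sum, Finset.sum_image hg]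
  have hsum : Summable (fun n : ℕ => r ^ n) := summable_geometric_of_lt_one hr0 hr1
  have h3 : ∑ n ∈ T.image g, r ^ n ≤ ∑' n : ℕ, r ^ n :=
    hsum.sum_le_tsum (T.image g) (fun n _ => pow_nonneg hr0 n)
  rw [tsum_geometric_of_lt_one hr0 hr1] at h3
  have h1r : 0 < 1 - r := by linarith
  calc ∑ m ∈ T, f m ≤ A * ∑ n ∈ T.image g, r ^ n := h1.trans h2.le
    _ ≤ A * (1 - r)⁻¹ := mul_le_mul_of_nonneg_left h3 hA
    _ = A / (1 - r) := by rw [div_eq_mul_inv]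

/-! ### The weighted envelope `2^{3m}·relayEnv₂ m` in the two zones -/

/-- Low zone (`m ≤ 2`): `2^{3m}·relayEnv₂ m = 32·(1/4)^{2−m}`. -/
theorem weighted_relayEnv₂_low {m : ℤ} (hm : m ≤ 2) :
    (2 : ℝ) ^ ((3 : ℝ) * (m : ℝ)) * relayEnv₂ m = 32 * (1 / 4 : ℝ) ^ (2 - m).toNat := by
  have key : ∀ a b : ℝ, (2 : ℝ) ^ a * (2 : ℝ) ^ b = (2 : ℝ) ^ (a + b) :=
    fun a b => (Real.rpow_add (by norm_num) a b).symm
  unfold relayEnv₂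
  rw [if_pos hm]
  have hn : (((2 - m).toNat : ℕ) : ℝ) = 2 - (m : ℝ) := by
    have h := Int.toNat_of_nonneg (show 0 ≤ 2 - m by omega)
    rw [← Int.cast_natCast, h]; push_cast; ring
  have h4 : (1 / 4 : ℝ) ^ (2 - m).toNat = (2 : ℝ) ^ (-(2 : ℝ) * (2 - (m : ℝ))) := by
    rw [← hn, ← Real.rpow_natCast, show (1 / 4 : ℝ) = (2 : ℝ) ^ (-(2 : ℝ)) by
      rw [Real.rpow_neg (by norm_num), Real.rpow_two]; norm_num, ← Real.rpow_mul (by norm_num)]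
  have h32 : (32 : ℝ) = (2 : ℝ) ^ (5 : ℝ) := by
    rw [show (5 : ℝ) = ((5 : ℕ) : ℝ) by norm_num, Real.rpow_natCast]; norm_num
  calc (2 : ℝ) ^ ((3 : ℝ) * (m : ℝ)) * (2 * (2 : ℝ) ^ (-(m : ℝ)))
      = (2 : ℝ) ^ ((3 : ℝ) * (m : ℝ)) * ((2 : ℝ) ^ (1 : ℝ) * (2 : ℝ) ^ (-(m : ℝ))) := by
        rw [Real.rpow_one]
    _ = (2 : ℝ) ^ ((3 : ℝ) * (m : ℝ) + (1 + -(m : ℝ))) := by rw [key, key]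
    _ = (2 : ℝ) ^ ((5 : ℝ) + -(2 : ℝ) * (2 - (m : ℝ))) := by congr 1; ring
    _ = 32 * (1 / 4 : ℝ) ^ (2 - m).toNat := by rw [h4, h32, key]

/-- High zone (`m ≥ 3`): `2^{3m}·relayEnv₂ m = 2^{−38}·(2^{−21})^{m−3}`. -/
theorem weighted_relayEnv₂_high {m : ℤ} (hm : 3 ≤ m) :
    (2 : ℝ) ^ ((3 : ℝ) * (m : ℝ)) * relayEnv₂ m =
      (2 : ℝ) ^ (-(38 : ℝ)) * ((2 : ℝ) ^ (-(21 : ℝ))) ^ (m - 3).toNat := by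
  have key : ∀ a b : ℝ, (2 : ℝ) ^ a * (2 : ℝ) ^ b = (2 : ℝ) ^ (a + b) :=
    fun a b => (Real.rpow_add (by norm_num) a b).symm
  unfold relayEnv₂
  rw [if_neg (by omega), rpow64_eq]
  have hn : (((m - 3).toNat : ℕ) : ℝ) = (m : ℝ) - 3 := by
    have h := Int.toNat_of_nonneg (show 0 ≤ m - 3 by omega)
    rw [← Int.cast_natCast, h]; push_cast; ring
  have hp : ((2 : ℝ) ^ (-(21 : ℝ))) ^ (m - 3).toNat = (2 : ℝ) ^ (-(21 : ℝ) * ((m : ℝ) - 3)) := by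
    rw [← hn, ← Real.rpow_natCast, ← Real.rpow_mul (by norm_num)]
  calc (2 : ℝ) ^ ((3 : ℝ) * (m : ℝ)) * (2 * (2 : ℝ) ^ (6 * (-(4 : ℝ) * ((m : ℝ) - 1))))
      = (2 : ℝ) ^ ((3 : ℝ) * (m : ℝ)) *
          ((2 : ℝ) ^ (1 : ℝ) * (2 : ℝ) ^ (6 * (-(4 : ℝ) * ((m : ℝ) - 1)))) := by rw [Real.rpow_one]
    _ = (2 : ℝ) ^ ((3 : ℝ) * (m : ℝ) + (1 + 6 * (-(4 : ℝ) * ((m : ℝ) - 1)))) := by rw [key, key]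
    _ = (2 : ℝ) ^ (-(38 : ℝ) + -(21 : ℝ) * ((m : ℝ) - 3)) := by congr 1; ring
    _ = (2 : ℝ) ^ (-(38 : ℝ)) * ((2 : ℝ) ^ (-(21 : ℝ))) ^ (m - 3).toNat := by rw [hp, key]

/-- `relayEnv₂ ≥ 0`. -/
theorem relayEnv₂_nonneg (m : ℤ) : 0 ≤ relayEnv₂ m := by
  unfold relayEnv₂; split_ifs <;> positivity

/-- **The weighted envelope has uniformly bounded finite sums**: for every finite `T ⊆ ℤ`,
`Σ_{m ∈ T} 2^{3m}·relayEnv₂ m ≤ 128/3 + 2^{−37}`. -/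
theorem weighted_relayEnv₂_sum_le (T : Finset ℤ) :
    ∑ m ∈ T, (2 : ℝ) ^ ((3 : ℝ) * (m : ℝ)) * relayEnv₂ m ≤ 128 / 3 + (2 : ℝ) ^ (-(37 : ℝ)) := by
  classical
  set f : ℤ → ℝ := fun m => (2 : ℝ) ^ ((3 : ℝ) * (m : ℝ)) * relayEnv₂ m with hf
  rw [← Finset.sum_filter_add_sum_filter_not T (fun m : ℤ => m ≤ 2)]
  -- low zone
  have hlow : ∑ m ∈ T.filter (fun m : ℤ => m ≤ 2), f m ≤ 32 / (1 - 1 / 4) := by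
    refine finset_sum_le_geometric (g := fun m : ℤ => (2 - m).toNat) (by norm_num) (by norm_num)
      (by norm_num) ?_ ?_
    · intro a ha b hb hab
      have ha2 : a ≤ 2 := (Finset.mem_filter.mp ha).2
      have hb2 : b ≤ 2 := (Finset.mem_filter.mp hb).2
      have h1 := Int.toNat_of_nonneg (show 0 ≤ 2 - a by omega)
      have h2 := Int.toNat_of_nonneg (show 0 ≤ 2 - b by omega)
      have hab' : ((2 - a).toNat : ℤ) = ((2 - b).toNat : ℤ) := by exact_mod_cast hab
      omega
    · intro m hm
      have hm2 : m ≤ 2 := (Finset.mem_filter.mp hm).2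
      simp only [hf]
      rw [weighted_relayEnv₂_low hm2]
  -- high zone
  have hhigh : ∑ m ∈ T.filter (fun m : ℤ => ¬m ≤ 2), f m ≤
      (2 : ℝ) ^ (-(38 : ℝ)) / (1 - (2 : ℝ) ^ (-(21 : ℝ))) := by
    have hr0 : 0 ≤ (2 : ℝ) ^ (-(21 : ℝ)) := (Real.rpow_pos_of_pos (by norm_num) _).le
    have hr1 : (2 : ℝ) ^ (-(21 : ℝ)) < 1 :=
      Real.rpow_lt_one_of_one_lt_of_neg (by norm_num) (by norm_num)
    refine finset_sum_le_geometric (g := fun m : ℤ => (m - 3).toNat)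
      (Real.rpow_pos_of_pos (by norm_num) _).le hr0 hr1 ?_ ?_
    · intro a ha b hb hab
      have ha2 : ¬a ≤ 2 := (Finset.mem_filter.mp ha).2
      have hb2 : ¬b ≤ 2 := (Finset.mem_filter.mp hb).2
      have h1 := Int.toNat_of_nonneg (show 0 ≤ a - 3 by omega)
      have h2 := Int.toNat_of_nonneg (show 0 ≤ b - 3 by omega)
      have hab' : ((a - 3).toNat : ℤ) = ((b - 3).toNat : ℤ) := by exact_mod_cast hab
      omega
    · intro m hm
      have hm3 : 3 ≤ m := by have := (Finset.mem_filter.mp hm).2; omega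
      simp only [hf]
      rw [weighted_relayEnv₂_high hm3]
  -- numerics: 32/(3/4) = 128/3 and 2^{-38}/(1 - 2^{-21}) ≤ 2^{-37}
  have e21 : (2 : ℝ) ^ (-(21 : ℝ)) = 1 / 2 ^ 21 := by
    rw [show (-(21 : ℝ)) = -((21 : ℕ) : ℝ) by norm_num, Real.rpow_neg (by norm_num), Real.rpow_natCast]
    norm_num
  have e38 : (2 : ℝ) ^ (-(38 : ℝ)) = 1 / 2 ^ 38 := by
    rw [show (-(38 : ℝ)) = -((38 : ℕ) : ℝ) by norm_num, Real.rpow_neg (by norm_num), Real.rpow_natCast]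
    norm_num
  have e37 : (2 : ℝ) ^ (-(37 : ℝ)) = 1 / 2 ^ 37 := by
    rw [show (-(37 : ℝ)) = -((37 : ℕ) : ℝ) by norm_num, Real.rpow_neg (by norm_num), Real.rpow_natCast]
    norm_num
  rw [e21, e38] at hhigh
  rw [e37]
  have n1 : (32 : ℝ) / (1 - 1 / 4) = 128 / 3 := by norm_num
  have n2 : (1 : ℝ) / 2 ^ 38 / (1 - 1 / 2 ^ 21) ≤ 1 / 2 ^ 37 := by norm_num
  linarith

/-! ### The `L`-free slack bound -/

/-- **`slackWeight 1 ½ 8 relayEnv₂ L k ≤ 8·2^{−k}·(128/3 + 2^{−37})` for every `L` and `k`.**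
[cite: Tao2016AveragedNS, §6.4 Lemma 6.7 (the cumulative energy bound behind `slackWeight`)] -/
theorem slackWeight_relayEnv₂_le (L : ℕ) (k : ℤ) :
    slackWeight 1 (1 / 2) 8 relayEnv₂ L k ≤ 8 * (2 : ℝ) ^ (-(k : ℝ)) * (128 / 3 + (2 : ℝ) ^ (-(37 : ℝ))) := by
  classical
  unfold slackWeight
  rw [show (1 + 1 : ℝ) = 2 by norm_num]
  -- termwise: 2^{2k} 2^{3d} env(k+d) = 2^{-k} (2^{3(k+d)} env(k+d))
  have hterm : ∀ d ∈ Finset.Icc 1 L,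
      (2 : ℝ) ^ ((2 : ℝ) * (k : ℝ)) * ((2 : ℝ) ^ ((5 / 2 + 1 / 2) * (d : ℝ)) * relayEnv₂ (k + d)) =
        (2 : ℝ) ^ (-(k : ℝ)) * ((2 : ℝ) ^ ((3 : ℝ) * (((k + d : ℤ)) : ℝ)) * relayEnv₂ (k + d)) := by
    intro d _
    have h2 : (2 : ℝ) ^ ((2 : ℝ) * (k : ℝ)) * (2 : ℝ) ^ ((5 / 2 + 1 / 2) * (d : ℝ)) =
        (2 : ℝ) ^ (-(k : ℝ)) * (2 : ℝ) ^ ((3 : ℝ) * (((k + d : ℤ)) : ℝ)) := by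
      rw [← Real.rpow_add (by norm_num), ← Real.rpow_add (by norm_num)]; congr 1; push_cast; ring
    rw [← mul_assoc, h2, mul_assoc]
  have hsum : (2 : ℝ) ^ ((2 : ℝ) * (k : ℝ)) *
      ∑ d ∈ Finset.Icc 1 L, (2 : ℝ) ^ ((5 / 2 + 1 / 2) * (d : ℝ)) * relayEnv₂ (k + d) =
      (2 : ℝ) ^ (-(k : ℝ)) *
        ∑ d ∈ Finset.Icc 1 L, (2 : ℝ) ^ ((3 : ℝ) * (((k + d : ℤ)) : ℝ)) * relayEnv₂ (k + d) := by
    rw [Finset.mul_sum, Finset.mul_sum]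
    exact Finset.sum_congr rfl hterm
  -- reindex d ↦ k + d
  have hre : ∑ d ∈ Finset.Icc 1 L, (2 : ℝ) ^ ((3 : ℝ) * (((k + d : ℤ)) : ℝ)) * relayEnv₂ (k + d) =
      ∑ m ∈ (Finset.Icc 1 L).image (fun d : ℕ => k + (d : ℤ)),
        (2 : ℝ) ^ ((3 : ℝ) * (m : ℝ)) * relayEnv₂ m := by
    rw [Finset.sum_image]
    intro a _ b _ hab
    have hab' : k + (a : ℤ) = k + (b : ℤ) := hab
    have : (a : ℤ) = b := by omega
    exact_mod_cast this
  have hfin := weighted_relayEnv₂_sum_le ((Finset.Icc 1 L).image (fun d : ℕ => k + (d : ℤ)))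
  rw [← hre] at hfin
  have hk : 0 ≤ 8 * (2 : ℝ) ^ (-(k : ℝ)) := by positivity
  calc 8 * (2 : ℝ) ^ ((2 : ℝ) * (k : ℝ)) *
        ∑ d ∈ Finset.Icc 1 L, (2 : ℝ) ^ ((5 / 2 + 1 / 2) * (d : ℝ)) * relayEnv₂ (k + d)
      = 8 * ((2 : ℝ) ^ ((2 : ℝ) * (k : ℝ)) *
          ∑ d ∈ Finset.Icc 1 L, (2 : ℝ) ^ ((5 / 2 + 1 / 2) * (d : ℝ)) * relayEnv₂ (k + d)) := by ring
    _ = 8 * (2 : ℝ) ^ (-(k : ℝ)) *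
          ∑ d ∈ Finset.Icc 1 L, (2 : ℝ) ^ ((3 : ℝ) * (((k + d : ℤ)) : ℝ)) * relayEnv₂ (k + d) := by
        rw [hsum]; ring
    _ ≤ 8 * (2 : ℝ) ^ (-(k : ℝ)) * (128 / 3 + (2 : ℝ) ^ (-(37 : ℝ))) :=
        mul_le_mul_of_nonneg_left hfin hk

/-- The numeric form on a block shell: `η·slackWeight ≤ 3.4134e-6 · 2^{−k}` with `η = 1e-8`. -/
theorem eta_slackWeight_le (L : ℕ) (k : ℤ) :
    (1 / 10 ^ 8 : ℝ) * slackWeight 1 (1 / 2) 8 relayEnv₂ L k ≤ 34134 / 10 ^ 10 * (2 : ℝ) ^ (-(k : ℝ)) := by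
  have h := slackWeight_relayEnv₂_le L k
  have h37 : (2 : ℝ) ^ (-(37 : ℝ)) ≤ 1 / 10 ^ 11 := by
    rw [show (-(37 : ℝ)) = -((37 : ℕ) : ℝ) by norm_num, Real.rpow_neg (by norm_num), Real.rpow_natCast]
    norm_num
  have hQ : 0 ≤ (2 : ℝ) ^ (-(k : ℝ)) := (Real.rpow_pos_of_pos (by norm_num) _).le
  nlinarith

/-! ### The registered stub -/

/-- **STUB `stub_slack` of LINE `window_v2` (registered signature, verbatim) — `L`-FREE SLACK BOUNDS on the
block shells `k = −3, …, 2`**: `B₀ ≤ (2.8e-5, 1.4e-5, 7e-6, 3.5e-6, 1.8e-6, 9e-7)` whenever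
`0 ≤ B₀ ≤ η·slackWeight 1 ½ 8 relayEnv₂ L k`, `η = 1e-8`, any `L`. MODEL-lattice bookkeeping; nothing about the
Navier–Stokes equations. [this file] -/
theorem stub_slack :
  ∀ (L : ℕ) (B₀ : Fin 4 → ℤ → ℝ),
    (∀ i k, 0 ≤ B₀ i k ∧ B₀ i k ≤ (1 / 10 ^ 8 : ℝ) * slackWeight 1 (1 / 2) 8 relayEnv₂ L k) →
      (∀ i, B₀ i (-3) ≤ 28 / 10 ^ 6) ∧ (∀ i, B₀ i (-2) ≤ 14 / 10 ^ 6) ∧ (∀ i, B₀ i (-1) ≤ 7 / 10 ^ 6) ∧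
      (∀ i, B₀ i 0 ≤ 35 / 10 ^ 7) ∧ (∀ i, B₀ i 1 ≤ 18 / 10 ^ 7) ∧ (∀ i, B₀ i 2 ≤ 9 / 10 ^ 7) := by
  intro L B₀ hB
  have key : ∀ (i : Fin 4) (k : ℤ), B₀ i k ≤ 34134 / 10 ^ 10 * (2 : ℝ) ^ (-(k : ℝ)) :=
    fun i k => (hB i k).2.trans (eta_slackWeight_le L k)
  have pow_eval : ∀ n : ℕ, (2 : ℝ) ^ (-(((-(n : ℤ)) : ℤ) : ℝ)) = 2 ^ n := by
    intro n
    rw [show (-(((-(n : ℤ)) : ℤ) : ℝ)) = ((n : ℕ) : ℝ) by push_cast; ring, Real.rpow_natCast]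
  have e3 : (2 : ℝ) ^ (-(((-3 : ℤ)) : ℝ)) = 8 := by
    have := pow_eval 3; push_cast at this ⊢; rw [this]; norm_num
  have e2 : (2 : ℝ) ^ (-(((-2 : ℤ)) : ℝ)) = 4 := by
    have := pow_eval 2; push_cast at this ⊢; rw [this]; norm_num
  have e1 : (2 : ℝ) ^ (-(((-1 : ℤ)) : ℝ)) = 2 := by
    have := pow_eval 1; push_cast at this ⊢; rw [this]; norm_num
  have e0 : (2 : ℝ) ^ (-(((0 : ℤ)) : ℝ)) = 1 := by norm_num
  have ep1 : (2 : ℝ) ^ (-(((1 : ℤ)) : ℝ)) = 1 / 2 := by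
    rw [show (-(((1 : ℤ)) : ℝ)) = -((1 : ℕ) : ℝ) by norm_num, Real.rpow_neg (by norm_num),
      Real.rpow_natCast]; norm_num
  have ep2 : (2 : ℝ) ^ (-(((2 : ℤ)) : ℝ)) = 1 / 4 := by
    rw [show (-(((2 : ℤ)) : ℝ)) = -((2 : ℕ) : ℝ) by norm_num, Real.rpow_neg (by norm_num),
      Real.rpow_natCast]; norm_num
  refine ⟨fun i => ?_, fun i => ?_, fun i => ?_, fun i => ?_, fun i => ?_, fun i => ?_⟩
  · have := key i (-3); rw [e3] at this; linarith
  · have := key i (-2); rw [e2] at this; linarith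
  · have := key i (-1); rw [e1] at this; linarith
  · have := key i 0; rw [e0] at this; linarith
  · have := key i 1; rw [ep1] at this; linarith
  · have := key i 2; rw [ep2] at this; linarith

end Summit.NavierStokesRegularity.NavierStokesRegularity.Cruxes.RelayFrontStep.Window2
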